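import Summits.KontsevichZagierPeriods.KontsevichZagierPeriods.Theses.TerasomaMultiplication
import Summits.KontsevichZagierPeriods.KontsevichZagierPeriods.Theorems.MultiplicationThree.Negative.Pinned
import Summits.KontsevichZagierPeriods.KontsevichZagierPeriods.Theorems.MultiplicationThree.Negative.BolzaLever
import Literature.NumberTheory.Transcendental.KZMellinFibres
import Literature.NumberTheory.Transcendental.KZSubcalculusInvariants
import Literature.NumberTheory.Transcendental.KZDominatedFamilyRelations
import Literature.NumberTheory.Transcendental.KZLogCalculusProofs
import Literature.NumberTheory.Transcendental.KZSemialgebraicComplex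
import Mathlib.Analysis.SpecialFunctions.Pow.Deriv

/-!
# `MultiplicationThree` (stmt-KontsevichZagierPeriods-3598), line `bolza-involution-real-quotient`:
# stub S4 — step (iii)a: the Möbius 2-torsion translation — real algebra of the maps

Auxiliary file of the stub `stub_negativeBranchToMaxCellImage` of the crux `MultiplicationThree`
(route `TerasomaMultiplication`; lead skeleton `Cruxes/MultiplicationThree/Lines/bolza-involution-real-quotient.lean`).

On the level `u ∈ (0,1)` the elliptic curve `E_u : w² = Q(a,u) := a²(3−a)² − 4ua` has the rational
`2`-torsion point `(a₁(u), 0)`, `a₁(u) ∈ (0,1)` the root of `a(3−a)² = 4u`; translation by it is a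
Möbius involution of the `a`-line mapping the negative branch `a < 0` onto the arc
`a₁ < a < (3−a₁)/2`. With the polynomial base change `u = U(t) := t(3−t)²/4` (`t = a₁`, a strictly
increasing bijection `(0,1) → (0,1)`) the translation is the rational map
`μ(t,a) = (3−t)(a−t)/(2a+t−3)`. This file supplies: monotonicity, range and surjectivity (IVT) of
`U` and its derivative `U′ = 3(3−t)(1−t)/4`; the identities `μ − t = 3a(1−t)/(2a+t−3)`,
`2μ + t − 3 = 3(3−t)(1−t)/(2a+t−3)`, the involution property `μ(t, μ(t,a)) = a` and the exact
Jacobian identity `Q(μ, U) = (∂μ/∂a)² Q(a, U)`, `∂μ/∂a = −3(3−t)(1−t)/(2a+t−3)²`; the cells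
`Σ' = {0<t<1, a<0}` (same formula as the negative branch `Σ_neg`) and
`maxCellImage = {0<c, 0<a′, 2a′<3, 4c<a′(3−a′)², (a′≤1 ∨ c<a′²(3−2a′))}`; and for the maps
`P(t,a) = (U(t), a)`, `PM(t,a) = (U(t), μ(t,a))`: `P '' Σ' = Σ_neg`, `PM '' Σ' = maxCellImage`,
injectivity on `Σ'`. Every expression is written out explicitly (no definitions, no notation); all
names carry the prefix `s4_`.

References: M. Kontsevich, D. Zagier, *Periods* (2001), §1.2 rule (2).
-/

noncomputable section

open Set MeasureTheory MvPolynomial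
open Literature.NumberTheory.Transcendental Literature.NumberTheory.Transcendental.KZ
open Literature.ModelTheory.ExponentialFields (IsSemialgebraic)

namespace Summit.KontsevichZagierPeriods.TerasomaMultiplication.MultiplicationThreeBolza

/-! ### The base change `U(t) = t(3−t)²/4` -/

/-- `U(x) − U(y) = (x − y)((3 − x − y)² − xy)/4`. [folklore] -/
theorem s4_U_sub_U (x y : ℝ) : (x * (3 - x) ^ 2 / 4) - (y * (3 - y) ^ 2 / 4) = (x - y) * ((3 - x - y) ^ 2 - x * y) / 4 := by
  ring

/-- `U` is strictly increasing on `[0, 1]`. [folklore] -/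
theorem s4_U_strictMonoOn : StrictMonoOn (fun t : ℝ => (t * (3 - t) ^ 2 / 4)) (Icc 0 1) := by
  intro x hx y hy hxy
  have hy0 : 0 < y := lt_of_le_of_lt hx.1 hxy
  have h3 : 1 < 3 - y - x := by linarith [hy.2, hx.2]
  have h1 : y * x < (3 - y - x) ^ 2 := by
    nlinarith [mul_lt_mul_of_pos_left hxy hy0, mul_le_mul_of_nonneg_left hy.2 hy0.le]
  have h := s4_U_sub_U y x
  have hpos : 0 < (y - x) * ((3 - y - x) ^ 2 - y * x) / 4 :=
    div_pos (mul_pos (sub_pos.2 hxy) (sub_pos.2 h1)) four_pos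
  show (x * (3 - x) ^ 2 / 4) < (y * (3 - y) ^ 2 / 4)
  linarith

/-- `U′ > 0` on `t < 1`. [folklore] -/
theorem s4_dU_pos {t : ℝ} (ht1 : t < 1) : 0 < (3 * (3 - t) * (1 - t) / 4) :=
  div_pos (mul_pos (mul_pos three_pos (by linarith)) (by linarith)) four_pos

/-- `U` maps `(0,1)` into `(0,1)`. [folklore] -/
theorem s4_U_mem {t : ℝ} (ht0 : 0 < t) (ht1 : t < 1) : 0 < (t * (3 - t) ^ 2 / 4) ∧ (t * (3 - t) ^ 2 / 4) < 1 := by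
  refine ⟨div_pos (mul_pos ht0 (pow_pos (by linarith) 2)) four_pos, ?_⟩
  have h : (t * (3 - t) ^ 2 / 4) < ((1:ℝ) * (3 - (1:ℝ)) ^ 2 / 4) := s4_U_strictMonoOn ⟨ht0.le, ht1.le⟩ ⟨zero_le_one, le_rfl⟩ ht1
  have h1 : ((1:ℝ) * (3 - (1:ℝ)) ^ 2 / 4) = 1 := by norm_num
  linarith

/-- `U` attains every value of `(0,1)` on `(0,1)` (intermediate value theorem). [folklore] -/
theorem s4_U_surj {c : ℝ} (hc0 : 0 < c) (hc1 : c < 1) : ∃ t : ℝ, 0 < t ∧ t < 1 ∧ (t * (3 - t) ^ 2 / 4) = c := by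
  have hcont : Continuous fun t : ℝ => (t * (3 - t) ^ 2 / 4) := by fun_prop
  have h := intermediate_value_Ioo (show (0:ℝ) ≤ 1 by norm_num) hcont.continuousOn
  have hc : c ∈ Ioo (((0:ℝ) * (3 - (0:ℝ)) ^ 2 / 4)) (((1:ℝ) * (3 - (1:ℝ)) ^ 2 / 4)) := ⟨by norm_num [hc0], by norm_num [hc1]⟩
  obtain ⟨t, ht, htc⟩ := h hc
  exact ⟨t, ht.1, ht.2, htc⟩

/-- `U′` is the derivative of `U`. [folklore] -/
theorem s4_hasDerivAt_U (t : ℝ) : HasDerivAt (fun y : ℝ => (y * (3 - y) ^ 2 / 4)) ((3 * (3 - t) * (1 - t) / 4)) t := by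
  have h1 : HasDerivAt (fun y : ℝ => y) 1 t := hasDerivAt_id t
  have h3 : HasDerivAt (fun y : ℝ => 3 - y) (-1) t := h1.const_sub 3
  have h2 : HasDerivAt (fun y : ℝ => y * ((3 - y) * (3 - y)) / 4)
      ((1 * ((3 - t) * (3 - t)) + t * (-1 * (3 - t) + (3 - t) * -1)) / 4) t :=
    (h1.mul (h3.mul h3)).div_const 4
  have e : (fun y : ℝ => (y * (3 - y) ^ 2 / 4)) = fun y : ℝ => y * ((3 - y) * (3 - y)) / 4 :=
    funext fun y => by ring
  rw [e]
  refine h2.congr_deriv ?_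
  ring

/-! ### The Möbius involution `μ(t, a) = (3 − t)(a − t)/(2a + t − 3)` -/

/-- `μ − t = 3a(1 − t)/(2a + t − 3)`. [folklore] -/
theorem s4_mu_sub (t a : ℝ) (hd : 2 * a + t - 3 ≠ 0) :
    ((3 - t) * (a - t) / (2 * a + t - 3)) - t = 3 * a * (1 - t) / (2 * a + t - 3) := by
  revert hd
  generalize hD : 2 * a + t - 3 = D
  intro hd
  field_simp
  subst hD
  ring

/-- `2μ + t − 3 = 3(3 − t)(1 − t)/(2a + t − 3)`. [folklore] -/
theorem s4_two_mu (t a : ℝ) (hd : 2 * a + t - 3 ≠ 0) :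
    2 * ((3 - t) * (a - t) / (2 * a + t - 3)) + t - 3 = 3 * (3 - t) * (1 - t) / (2 * a + t - 3) := by
  revert hd
  generalize hD : 2 * a + t - 3 = D
  intro hd
  field_simp
  subst hD
  ring

/-- `μ(t, ·)` is an involution (its Möbius matrix has trace `0`). [folklore] -/
theorem s4_mu_mu {t a : ℝ} (hd : 2 * a + t - 3 ≠ 0) (h1 : 1 - t ≠ 0) (h3 : 3 - t ≠ 0) :
    ((3 - t) * (((3 - t) * (a - t) / (2 * a + t - 3)) - t) / (2 * ((3 - t) * (a - t) / (2 * a + t - 3)) + t - 3)) = a := by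
  rw [s4_mu_sub t a hd, s4_two_mu t a hd, mul_div_assoc', div_div_div_cancel_right₀ hd,
    div_eq_iff (mul_ne_zero (mul_ne_zero three_ne_zero h3) h1)]
  ring

/-- For `0 < t < 1`, `a < 0`: `t < μ(t,a)` and `2μ(t,a) + t < 3`. [folklore] -/
theorem s4_mu_mem {t a : ℝ} (ht0 : 0 < t) (ht1 : t < 1) (ha : a < 0) :
    t < ((3 - t) * (a - t) / (2 * a + t - 3)) ∧ 2 * ((3 - t) * (a - t) / (2 * a + t - 3)) + t - 3 < 0 := by
  have hd : 2 * a + t - 3 < 0 := by linarith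
  refine ⟨?_, ?_⟩
  · have h := s4_mu_sub t a hd.ne
    have : 0 < 3 * a * (1 - t) / (2 * a + t - 3) :=
      div_pos_of_neg_of_neg (mul_neg_of_neg_of_pos (by linarith) (by linarith)) hd
    linarith
  · rw [s4_two_mu t a hd.ne]
    exact div_neg_of_pos_of_neg (mul_pos (mul_pos three_pos (by linarith)) (by linarith)) hd

/-- For `t < a`, `2a + t < 3`: `μ(t, a) < 0`. [folklore] -/
theorem s4_mu_neg {t a : ℝ} (hta : t < a) (hd : 2 * a + t - 3 < 0) : ((3 - t) * (a - t) / (2 * a + t - 3)) < 0 :=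
  div_neg_of_pos_of_neg (mul_pos (by linarith) (by linarith)) hd

/-- `Q(μ(t,a), U(t)) = (∂μ/∂a)² · Q(a, U(t))`: the translation preserves `da/√Q` (exact identity). [folklore] -/
theorem s4_Q_PM {t a : ℝ} (hd : 2 * a + t - 3 ≠ 0) :
    ((3 - t) * (a - t) / (2 * a + t - 3)) ^ 2 * (3 - ((3 - t) * (a - t) / (2 * a + t - 3))) ^ 2 - 4 * (t * (3 - t) ^ 2 / 4) * ((3 - t) * (a - t) / (2 * a + t - 3)) =
      (-(3 * (3 - t) * (1 - t)) / (2 * a + t - 3) ^ 2) ^ 2 * (a ^ 2 * (3 - a) ^ 2 - 4 * (t * (3 - t) ^ 2 / 4) * a) := by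
  revert hd
  generalize hD : 2 * a + t - 3 = D
  intro hd
  field_simp
  subst hD
  ring

/-- For `0 < t < 1`, `t < a`, `2a + t < 3`: `U(t) < U(a)` (so `4U(t) < a(3 − a)²`). [folklore] -/
theorem s4_U_lt_U {t a : ℝ} (ht0 : 0 < t) (ht1 : t < 1) (hta : t < a) (hd : 2 * a + t - 3 < 0) :
    (t * (3 - t) ^ 2 / 4) < (a * (3 - a) ^ 2 / 4) := by
  have hb : a < (3 - t) / 2 := by linarith
  have h1 : a * t < ((3 - t) / 2) ^ 2 := by
    nlinarith [mul_pos (sub_pos.2 hb) ht0,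
      mul_pos (show (0:ℝ) < (3 - t) / 2 - t by linarith) (show (0:ℝ) < (3 - t) / 2 by linarith)]
  have h2 : ((3 - t) / 2) ^ 2 < (3 - a - t) ^ 2 := by
    nlinarith [mul_pos (show (0:ℝ) < 3 - a - t - (3 - t) / 2 by linarith)
      (show (0:ℝ) < 3 - a - t + (3 - t) / 2 by linarith)]
  have h := s4_U_sub_U a t
  have hpos : 0 < (a - t) * ((3 - a - t) ^ 2 - a * t) / 4 :=
    div_pos (mul_pos (sub_pos.2 hta) (by linarith)) four_pos
  linarith

/-- `h(x) = x²(3 − 2x)` is strictly decreasing on `(1, ∞)`. [folklore] -/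
theorem s4_h_anti {x y : ℝ} (hx : 1 < x) (hxy : x < y) :
    y ^ 2 * (3 - 2 * y) < x ^ 2 * (3 - 2 * x) := by
  have hp : 0 < x - 1 := by linarith
  have hq : 0 < y - 1 := by linarith
  have h : 0 < 2 * x ^ 2 + 2 * x * y + 2 * y ^ 2 - 3 * x - 3 * y := by
    nlinarith [mul_pos hp hq, sq_nonneg (x - 1), sq_nonneg (y - 1)]
  nlinarith [mul_pos (sub_pos.2 hxy) h]

/-! ### The cells and the maps `P(t,a) = (U(t), a)`, `PM(t,a) = (U(t), μ(t,a))` -/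

/-- On `Σ'` the denominator of `μ` is negative, in particular non-zero. [folklore] -/
theorem s4_den_ne {y : Fin 2 → ℝ} (hy : y ∈ {x : Fin 2 → ℝ | 0 < x 0 ∧ x 0 < 1 ∧ x 1 < 0}) : 2 * y 1 + y 0 - 3 ≠ 0 := by
  obtain ⟨-, h1, ha⟩ := hy
  exact (show 2 * y 1 + y 0 - 3 < 0 by linarith).ne

/-- `Q > 0` on the image cell: `Q = a′(a′(3−a′)² − 4c)`. [folklore] -/
theorem s4_Q_pos_img {x : Fin 2 → ℝ} (hx : x ∈ {x : Fin 2 → ℝ | 0 < x 0 ∧ 0 < x 1 ∧ 2 * x 1 < 3 ∧ 4 * x 0 < x 1 * (3 - x 1) ^ 2 ∧ (x 1 ≤ 1 ∨ x 0 < x 1 ^ 2 * (3 - 2 * x 1))}) :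
    0 < x 1 ^ 2 * (3 - x 1) ^ 2 - 4 * x 0 * x 1 := by
  obtain ⟨-, h1, -, h4, -⟩ := hx
  have e : x 1 ^ 2 * (3 - x 1) ^ 2 - 4 * x 0 * x 1 = x 1 * (x 1 * (3 - x 1) ^ 2 - 4 * x 0) := by ring
  rw [e]; exact mul_pos h1 (by linarith)

/-- `Q(a, U(t)) > 0` on `Σ'` (`a < 0 < U(t)`). [folklore] -/
theorem s4_QP_pos {y : Fin 2 → ℝ} (hy : y ∈ {x : Fin 2 → ℝ | 0 < x 0 ∧ x 0 < 1 ∧ x 1 < 0}) :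
    0 < y 1 ^ 2 * (3 - y 1) ^ 2 - 4 * (y 0 * (3 - y 0) ^ 2 / 4) * y 1 := by
  obtain ⟨h0, h1, ha⟩ := hy
  have hU := (s4_U_mem h0 h1).1
  have : 0 < 4 * (y 0 * (3 - y 0) ^ 2 / 4) * (-(y 1)) := mul_pos (mul_pos four_pos hU) (neg_pos.2 ha)
  nlinarith [sq_nonneg (y 1 * (3 - y 1))]

/-- `P` maps `Σ'` into `Σ_neg`. [folklore] -/
theorem s4_mapsTo_P : MapsTo (fun y : Fin 2 → ℝ => (![(y 0 * (3 - y 0) ^ 2 / 4), y 1] : Fin 2 → ℝ)) {x : Fin 2 → ℝ | 0 < x 0 ∧ x 0 < 1 ∧ x 1 < 0} {x : Fin 2 → ℝ | 0 < x 0 ∧ x 0 < 1 ∧ x 1 < 0} := fun _ ⟨h0, h1, ha⟩ =>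
  ⟨(s4_U_mem h0 h1).1, (s4_U_mem h0 h1).2, ha⟩

/-- `P` maps `Σ'` ONTO `Σ_neg`. [folklore] -/
theorem s4_image_P : (fun y : Fin 2 → ℝ => (![(y 0 * (3 - y 0) ^ 2 / 4), y 1] : Fin 2 → ℝ)) '' {x : Fin 2 → ℝ | 0 < x 0 ∧ x 0 < 1 ∧ x 1 < 0} = {x : Fin 2 → ℝ | 0 < x 0 ∧ x 0 < 1 ∧ x 1 < 0} := by
  refine s4_mapsTo_P.image_subset.antisymm fun x ⟨hc0, hc1, ha⟩ => ?_
  obtain ⟨t, ht0, ht1, htc⟩ := s4_U_surj hc0 hc1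
  refine ⟨![t, x 1], ⟨ht0, ht1, ha⟩, ?_⟩
  funext i
  fin_cases i
  · exact htc
  · rfl

/-- `P` is injective on `Σ'`. [folklore] -/
theorem s4_injOn_P : InjOn (fun y : Fin 2 → ℝ => (![(y 0 * (3 - y 0) ^ 2 / 4), y 1] : Fin 2 → ℝ)) {x : Fin 2 → ℝ | 0 < x 0 ∧ x 0 < 1 ∧ x 1 < 0} := by
  rintro y ⟨hy0, hy1, -⟩ z ⟨hz0, hz1, -⟩ h
  have e0 := congrFun h 0
  have e1 := congrFun h 1
  simp only [Matrix.cons_val_zero, Matrix.cons_val_one] at e0 e1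
  have h0 : y 0 = z 0 := s4_U_strictMonoOn.injOn ⟨hy0.le, hy1.le⟩ ⟨hz0.le, hz1.le⟩ e0
  funext i
  fin_cases i
  · exact h0
  · exact e1

/-- `PM` maps `Σ'` into the image cell. [folklore] -/
theorem s4_mapsTo_PM : MapsTo (fun y : Fin 2 → ℝ => (![(y 0 * (3 - y 0) ^ 2 / 4), ((3 - y 0) * (y 1 - y 0) / (2 * y 1 + y 0 - 3))] : Fin 2 → ℝ)) {x : Fin 2 → ℝ | 0 < x 0 ∧ x 0 < 1 ∧ x 1 < 0} {x : Fin 2 → ℝ | 0 < x 0 ∧ 0 < x 1 ∧ 2 * x 1 < 3 ∧ 4 * x 0 < x 1 * (3 - x 1) ^ 2 ∧ (x 1 ≤ 1 ∨ x 0 < x 1 ^ 2 * (3 - 2 * x 1))} := by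
  rintro y ⟨ht0, ht1, ha⟩
  obtain ⟨hmu1, hmu2⟩ := s4_mu_mem ht0 ht1 ha
  have hU := s4_U_mem ht0 ht1
  refine ⟨hU.1, lt_trans ht0 hmu1, ?_, ?_, ?_⟩
  · show 2 * ((3 - y 0) * (y 1 - y 0) / (2 * y 1 + y 0 - 3)) < 3
    linarith
  · show 4 * (y 0 * (3 - y 0) ^ 2 / 4) < ((3 - y 0) * (y 1 - y 0) / (2 * y 1 + y 0 - 3)) * (3 - ((3 - y 0) * (y 1 - y 0) / (2 * y 1 + y 0 - 3))) ^ 2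
    linarith [s4_U_lt_U ht0 ht1 hmu1 hmu2]
  · show ((3 - y 0) * (y 1 - y 0) / (2 * y 1 + y 0 - 3)) ≤ 1 ∨ (y 0 * (3 - y 0) ^ 2 / 4) < ((3 - y 0) * (y 1 - y 0) / (2 * y 1 + y 0 - 3)) ^ 2 * (3 - 2 * ((3 - y 0) * (y 1 - y 0) / (2 * y 1 + y 0 - 3)))
    by_cases h1 : ((3 - y 0) * (y 1 - y 0) / (2 * y 1 + y 0 - 3)) ≤ 1
    · exact Or.inl h1
    · refine Or.inr ?_
      have hb : ((3 - y 0) * (y 1 - y 0) / (2 * y 1 + y 0 - 3)) < (3 - y 0) / 2 := by linarith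
      have h := s4_h_anti (not_le.1 h1) hb
      have e : ((3 - y 0) / 2) ^ 2 * (3 - 2 * ((3 - y 0) / 2)) = (y 0 * (3 - y 0) ^ 2 / 4) := by ring
      linarith

/-- `PM` maps `Σ'` ONTO the image cell. [folklore] -/
theorem s4_image_PM : (fun y : Fin 2 → ℝ => (![(y 0 * (3 - y 0) ^ 2 / 4), ((3 - y 0) * (y 1 - y 0) / (2 * y 1 + y 0 - 3))] : Fin 2 → ℝ)) '' {x : Fin 2 → ℝ | 0 < x 0 ∧ x 0 < 1 ∧ x 1 < 0} = {x : Fin 2 → ℝ | 0 < x 0 ∧ 0 < x 1 ∧ 2 * x 1 < 3 ∧ 4 * x 0 < x 1 * (3 - x 1) ^ 2 ∧ (x 1 ≤ 1 ∨ x 0 < x 1 ^ 2 * (3 - 2 * x 1))} := by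
  refine s4_mapsTo_PM.image_subset.antisymm fun x ⟨hc, ha0, ha3, h4, h5⟩ => ?_
  have hc1 : x 0 < 1 := by
    nlinarith [mul_nonneg (sq_nonneg (1 - x 1)) (show (0:ℝ) ≤ 4 - x 1 by linarith)]
  obtain ⟨t, ht0, ht1, htc⟩ := s4_U_surj hc hc1
  have hta : t < x 1 := by
    rcases le_or_gt (x 1) 1 with h1 | h1
    · refine (s4_U_strictMonoOn.lt_iff_lt ⟨ht0.le, ht1.le⟩ ⟨ha0.le, h1⟩).1 ?_
      show (t * (3 - t) ^ 2 / 4) < (x 1 * (3 - x 1) ^ 2 / 4)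
      rw [htc]; linarith
    · linarith
  have hd : 2 * x 1 + t - 3 < 0 := by
    rcases le_or_gt (x 1) 1 with h1 | h1
    · linarith
    · have h5' : x 0 < x 1 ^ 2 * (3 - 2 * x 1) := h5.resolve_left (not_le.2 h1)
      by_contra hge
      have hb : (3 - t) / 2 ≤ x 1 := by linarith [not_lt.1 hge]
      have e : ((3 - t) / 2) ^ 2 * (3 - 2 * ((3 - t) / 2)) = x 0 := by rw [← htc]; ring
      rcases hb.lt_or_eq with hlt | heq
      · have := s4_h_anti (show (1:ℝ) < (3 - t) / 2 by linarith) hlt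
        linarith
      · rw [heq] at e; linarith
  refine ⟨![t, ((3 - t) * (x 1 - t) / (2 * x 1 + t - 3))], ⟨ht0, ht1, s4_mu_neg hta hd⟩, ?_⟩
  funext i
  fin_cases i
  · exact htc
  · exact s4_mu_mu hd.ne (sub_pos.2 ht1).ne' (show (3:ℝ) - t ≠ 0 by linarith)

/-- `PM` is injective on `Σ'`. [folklore] -/
theorem s4_injOn_PM : InjOn (fun y : Fin 2 → ℝ => (![(y 0 * (3 - y 0) ^ 2 / 4), ((3 - y 0) * (y 1 - y 0) / (2 * y 1 + y 0 - 3))] : Fin 2 → ℝ)) {x : Fin 2 → ℝ | 0 < x 0 ∧ x 0 < 1 ∧ x 1 < 0} := by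
  rintro y ⟨hy0, hy1, hya⟩ z ⟨hz0, hz1, hza⟩ h
  have e0 := congrFun h 0
  have e1 := congrFun h 1
  simp only [Matrix.cons_val_zero, Matrix.cons_val_one] at e0 e1
  have h0 : y 0 = z 0 := s4_U_strictMonoOn.injOn ⟨hy0.le, hy1.le⟩ ⟨hz0.le, hz1.le⟩ e0
  rw [h0] at e1
  have h1t : (1:ℝ) - z 0 ≠ 0 := (sub_pos.2 hz1).ne'
  have h3t : (3:ℝ) - z 0 ≠ 0 := by
    have : (0:ℝ) < 3 - z 0 := by linarith
    exact this.ne'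
  have hdy : 2 * y 1 + z 0 - 3 ≠ 0 := (show 2 * y 1 + z 0 - 3 < 0 by linarith).ne
  have hdz : 2 * z 1 + z 0 - 3 ≠ 0 := (show 2 * z 1 + z 0 - 3 < 0 by linarith).ne
  funext i
  fin_cases i
  · exact h0
  · show y 1 = z 1
    rw [← s4_mu_mu hdy h1t h3t, e1, s4_mu_mu hdz h1t h3t]

end Summit.KontsevichZagierPeriods.TerasomaMultiplication.MultiplicationThreeBolza

end
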